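import Summits.CriticalPhenomena.PercolationContinuityZ3.Theorems.PercNearOneGluingNoHeavyLowerTailAttachedChampionLevelOneTools
import HarnessLib

/-!
# `NoHeavyLowerTail` (stmt-CriticalPhenomena-4575) — the attached-champion inequality at LEVEL ONE

Lead of the crux, 2026-08-18.  Bond percolation `μ = prodBernoulli w` on `Fin n`, relays `A`, observer `o`,
`N = |{a ∈ A : o ↔ a}|`, `D_a = {a ↮ A ∖ a}` (`= {|π(a)| ≤ 1}` for `a ∈ A`).  The registered stub
`stub_attachedChampion` (XZ) at level `j` reads `P(1 ≤ N ≤ j) ≤ P(|π(q)| ≤ j ∧ o ↔ A)` for a level-`j`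
champion `q`.  This file PROVES the level `j = 1`:

* `attachedChampion_level_one` — if `q ∈ A` and `μ(D_a) ≤ μ(D_q)` for all `a ∈ A`, then
  `μ(N = 1) ≤ μ(D_q ∩ {o ↔ A})`, i.e. `P(N = 1) ≤ P(π(q) = {q}, o ↔ A)`.

This sharpens the lonely-relay lemma `Theorems.lonelyRelay` (`P(N = 1) ≤ max_a P(D_a)`, Kozma–Nitzan Lemma 2)
by the factor `P(o ↔ A | D_q)`.  The chain for a non-null separation event is
`AttachedChampionLevelOne.level_one_of_pairSep_pos` (tools file); here the null case is removed by scaling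
the weights (`stub_weightContinuity`), carrying the champion hypothesis as a deficiency term, and the events
are identified with the stub's `Finset.filter`/`card` vocabulary.
-/

noncomputable section

namespace Summit.CriticalPhenomena.PercolationContinuityZ3.Theorems

open MeasureTheory Set Filter Literature.Probability.LatticeModels Literature.Probability.Percolation
open scoped Classical BigOperators Topology

namespace AttachedChampionLevelOne

variable {n : ℕ}

/-- **Removing the null case by scaling the weights** (as in `lonelyRelay_of_terminalSeparation`): for every
weight function, `q ∈ A` with `μ(D_b) ≤ μ(D_q)` for all `b ∈ A` gives `μ(N = 1) ≤ μ(D_q ∩ {o ↔ A})`. -/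
theorem level_one_of_terminalSeparation
    (hTS : ∀ (n : ℕ) (w : Sym2 (Fin n) → unitInterval) (T : Finset (Fin n)) (o a : Fin n),
      (prodBernoulli w).real (openConn o a ∩ {ω | ∀ t ∈ T, ω ∉ openConn a t}) *
        (prodBernoulli w).real ({ω | ∀ t ∈ T, ω ∉ openConn a t} ∩
            {ω | ∀ t ∈ T, ∀ t' ∈ T, t ≠ t' → ω ∉ openConn t t'}) ≤
      (prodBernoulli w).real {ω | ∀ t ∈ T, ω ∉ openConn a t} *
        (prodBernoulli w).real (openConn o a ∩ ({ω | ∀ t ∈ T, ω ∉ openConn a t} ∩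
              {ω | ∀ t ∈ T, ∀ t' ∈ T, t ≠ t' → ω ∉ openConn t t'})))
    (hcont : ∀ (n : ℕ) (E : Set (BondConfig (Fin n))),
      Continuous fun w : Sym2 (Fin n) → unitInterval => (prodBernoulli w).real E)
    (w : Sym2 (Fin n) → unitInterval) (A : Finset (Fin n)) (o q : Fin n) (hq : q ∈ A)
    (hchamp : ∀ b ∈ A, (prodBernoulli w).real {ω | ∀ t ∈ A.erase b, ω ∉ openConn b t} ≤
      (prodBernoulli w).real {ω | ∀ t ∈ A.erase q, ω ∉ openConn q t}) :
    (prodBernoulli w).real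
        {ω : Set (Sym2 (Fin n)) | (A.filter fun a => ω ∈ openConn o a).card = 1} ≤
      (prodBernoulli w).real ({ω | ∀ t ∈ A.erase q, ω ∉ openConn q t} ∩ ⋃ a ∈ A, openConn o a) := by
  -- scaled weights `w_k = (1 - 1/(k+1)) • w`, all `< 1`, converging to `w`
  have hcmem : ∀ k : ℕ, ((1 : ℝ) - 1 / ((k : ℝ) + 1)) ∈ unitInterval := by
    intro k
    have hk : (0 : ℝ) < (k : ℝ) + 1 := Nat.cast_add_one_pos k
    have h1 : 1 / ((k : ℝ) + 1) ≤ 1 := by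
      rw [div_le_one hk]; linarith [(Nat.cast_nonneg k : (0 : ℝ) ≤ k)]
    have h0 : 0 ≤ 1 / ((k : ℝ) + 1) := by positivity
    exact ⟨by linarith, by linarith⟩
  set wk : ℕ → Sym2 (Fin n) → unitInterval :=
    fun k e => ⟨(1 - 1 / ((k : ℝ) + 1)) * (w e : ℝ), unitInterval.mul_mem (hcmem k) (w e).2⟩
    with hwk_def
  have hwk_lt : ∀ k e, ((wk k e : unitInterval) : ℝ) < 1 := by
    intro k e
    have hk : (0 : ℝ) < (k : ℝ) + 1 := Nat.cast_add_one_pos k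
    have hc : (1 : ℝ) - 1 / ((k : ℝ) + 1) < 1 := by
      have : 0 < 1 / ((k : ℝ) + 1) := by positivity
      linarith
    calc ((wk k e : unitInterval) : ℝ) = (1 - 1 / ((k : ℝ) + 1)) * (w e : ℝ) := rfl
      _ ≤ (1 - 1 / ((k : ℝ) + 1)) := mul_le_of_le_one_right (hcmem k).1 (w e).2.2
      _ < 1 := hc
  have hc_lim : Tendsto (fun k : ℕ => (1 : ℝ) - 1 / ((k : ℝ) + 1)) atTop (𝓝 1) := by
    simpa using tendsto_const_nhds.sub (tendsto_one_div_add_atTop_nhds_zero_nat (𝕜 := ℝ))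
  have hwk_lim : Tendsto wk atTop (𝓝 w) := by
    refine tendsto_pi_nhds.2 fun e => ?_
    rw [tendsto_subtype_rng]
    have h := hc_lim.mul_const (w e : ℝ)
    rw [one_mul] at h
    exact h
  have hlimE : ∀ E : Set (Set (Sym2 (Fin n))),
      Tendsto (fun k => (prodBernoulli (wk k)).real E) atTop (𝓝 ((prodBernoulli w).real E)) :=
    fun E => ((hcont n E).tendsto w).comp hwk_lim
  -- error terms `δ k = ∑_{a ∈ A} |μ_{w_k}(D_a) - μ_w(D_a)| → 0`
  set δ : ℕ → ℝ := fun k => ∑ a ∈ A,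
      |(prodBernoulli (wk k)).real {ω | ∀ t ∈ A.erase a, ω ∉ openConn a t} -
        (prodBernoulli w).real {ω | ∀ t ∈ A.erase a, ω ∉ openConn a t}|
    with hδ_def
  have hδ0 : ∀ k, 0 ≤ δ k := fun k => Finset.sum_nonneg fun a _ => abs_nonneg _
  have hδ_lim : Tendsto δ atTop (𝓝 0) := by
    have h : ∀ a ∈ A, Tendsto (fun k =>
        |(prodBernoulli (wk k)).real {ω | ∀ t ∈ A.erase a, ω ∉ openConn a t} -
          (prodBernoulli w).real {ω | ∀ t ∈ A.erase a, ω ∉ openConn a t}|)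
        atTop (𝓝 0) := by
      intro a _
      simpa using (tendsto_sub_nhds_zero_iff.2
        (hlimE {ω | ∀ t ∈ A.erase a, ω ∉ openConn a t})).abs
    simpa [hδ_def] using tendsto_finsetSum A h
  have hδa : ∀ k, ∀ a ∈ A,
      |(prodBernoulli (wk k)).real {ω | ∀ t ∈ A.erase a, ω ∉ openConn a t} -
        (prodBernoulli w).real {ω | ∀ t ∈ A.erase a, ω ∉ openConn a t}| ≤ δ k := by
    intro k a ha
    exact Finset.single_le_sum (f := fun a =>
        |(prodBernoulli (wk k)).real {ω | ∀ t ∈ A.erase a, ω ∉ openConn a t} -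
          (prodBernoulli w).real {ω | ∀ t ∈ A.erase a, ω ∉ openConn a t}|)
      (fun a _ => abs_nonneg _) ha
  -- the bound at each `k`, with deficiency `2 δ k`
  have hk : ∀ k, (prodBernoulli (wk k)).real {ω : Set (Sym2 (Fin n)) |
      (A.filter fun a => ω ∈ openConn o a).card = 1} ≤
      (prodBernoulli (wk k)).real ({ω | ∀ t ∈ A.erase q, ω ∉ openConn q t} ∩ ⋃ a ∈ A, openConn o a) +
        2 * δ k := by
    intro k
    refine level_one_of_pairSep_pos hTS (wk k) A o q (2 * δ k) (by linarith [hδ0 k]) hq ?_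
      (singleFinger_pairSep_real_pos (wk k) (hwk_lt k) _)
    intro b hb
    have h1 := hchamp b hb
    have h2 := (abs_sub_le_iff.1 (hδa k b hb)).1
    have h3 := (abs_sub_le_iff.1 (hδa k q hq)).2
    linarith
  -- pass to the limit
  have hlim2 : Tendsto (fun k => (prodBernoulli (wk k)).real
      ({ω | ∀ t ∈ A.erase q, ω ∉ openConn q t} ∩ ⋃ a ∈ A, openConn o a) + 2 * δ k) atTop
      (𝓝 ((prodBernoulli w).real ({ω | ∀ t ∈ A.erase q, ω ∉ openConn q t} ∩ ⋃ a ∈ A, openConn o a))) := by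
    simpa using (hlimE _).add (hδ_lim.const_mul 2)
  exact le_of_tendsto_of_tendsto' (hlimE _) hlim2 hk

/-- `{N = 1}` is the stub's event `{1 ≤ N ∧ N ≤ 1}`. [folklore] -/
theorem setOf_card_eq_one_eq (A : Finset (Fin n)) (o : Fin n) :
    {ω : Set (Sym2 (Fin n)) | (A.filter fun a => ω ∈ openConn o a).card = 1} =
      {ω | 1 ≤ (A.filter fun a => ω ∈ openConn o a).card ∧ (A.filter fun a => ω ∈ openConn o a).card ≤ 1} := by
  ext ω; simp only [Set.mem_setOf_eq]; omega

/-- For `q ∈ A`: `{|π(q)| ≤ 1} = {q ↮ A ∖ q}`. [folklore] -/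
theorem setOf_card_le_one_eq (A : Finset (Fin n)) {q : Fin n} (hq : q ∈ A) :
    {ω : Set (Sym2 (Fin n)) | (A.filter fun x => ω ∈ openConn q x).card ≤ 1} =
      {ω | ∀ t ∈ A.erase q, ω ∉ openConn q t} := by
  ext ω
  simp only [Set.mem_setOf_eq]
  have hqmem : q ∈ A.filter fun x => ω ∈ openConn q x :=
    Finset.mem_filter.2 ⟨hq, (SimpleGraph.Reachable.refl q : (openGraph ω).Reachable q q)⟩
  constructor
  · intro hcard t ht hqt
    obtain ⟨htq, htA⟩ := Finset.mem_erase.1 ht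
    have htmem : t ∈ A.filter fun x => ω ∈ openConn q x := Finset.mem_filter.2 ⟨htA, hqt⟩
    have h2 : 2 ≤ (A.filter fun x => ω ∈ openConn q x).card := by
      have : ({q, t} : Finset (Fin n)) ⊆ A.filter fun x => ω ∈ openConn q x := by
        intro x hx
        rcases Finset.mem_insert.1 hx with rfl | hx
        · exact hqmem
        · rw [Finset.mem_singleton.1 hx]; exact htmem
      have hcard2 : ({q, t} : Finset (Fin n)).card = 2 := Finset.card_pair (Ne.symm htq)
      exact hcard2 ▸ Finset.card_le_card this
    omega
  · intro hsep
    have hsub : (A.filter fun x => ω ∈ openConn q x) ⊆ {q} := by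
      intro x hx
      obtain ⟨hxA, hqx⟩ := Finset.mem_filter.1 hx
      rw [Finset.mem_singleton]
      by_contra hxq
      exact hsep x (Finset.mem_erase.2 ⟨hxq, hxA⟩) hqx
    exact (Finset.card_le_card hsub).trans (by simp)

/-- `{1 ≤ N} = {o ↔ A}`. [folklore] -/
theorem setOf_one_le_card_eq (A : Finset (Fin n)) (o : Fin n) :
    {ω : Set (Sym2 (Fin n)) | 1 ≤ (A.filter fun x => ω ∈ openConn o x).card} = ⋃ a ∈ A, openConn o a := by
  ext ω
  simp only [Set.mem_setOf_eq, Set.mem_iUnion, exists_prop, Nat.one_le_iff_ne_zero, Ne,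
    Finset.card_eq_zero, Finset.filter_eq_empty_iff, not_forall, not_not]

end AttachedChampionLevelOne

open AttachedChampionLevelOne in
/-- **The attached-champion inequality at level one** (the `j = 1` instance of the registered stub
`stub_attachedChampion`, unconditional): for every weighted graph on `Fin n`, observer `o ∉ A` and level-1
champion `q ∈ A` (`μ(|π(a)| ≤ 1) ≤ μ(|π(q)| ≤ 1)` for all `a ∈ A`),
`μ(1 ≤ N ≤ 1) ≤ μ(|π(q)| ≤ 1 ∧ 1 ≤ N)`, i.e. `P(N = 1) ≤ P(π(q) = {q}, o ↔ A)` — Kozma–Nitzan's lonely relay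
lemma sharpened by the attachment factor.  Inputs: BHK 2006 Thm 1.3 (single vertex: `stub_terminalSeparation`;
vertex set: `BHK2006_setClusterConditionalPositiveAssociation`) and weight continuity. -/
theorem attachedChampion_level_one (n : ℕ) (w : Sym2 (Fin n) → unitInterval) (A : Finset (Fin n))
    (o q : Fin n) (_ho : o ∉ A) (hq : q ∈ A)
    (hchamp : ∀ a ∈ A,
      (Literature.Probability.LatticeModels.prodBernoulli w).real
          {ω : Literature.Probability.Percolation.BondConfig (Fin n) |
            (A.filter fun x => ω ∈ Literature.Probability.Percolation.openConn a x).card ≤ 1} ≤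
        (Literature.Probability.LatticeModels.prodBernoulli w).real
          {ω : Literature.Probability.Percolation.BondConfig (Fin n) |
            (A.filter fun x => ω ∈ Literature.Probability.Percolation.openConn q x).card ≤ 1}) :
    (Literature.Probability.LatticeModels.prodBernoulli w).real
        {ω : Literature.Probability.Percolation.BondConfig (Fin n) |
          1 ≤ (A.filter fun x => ω ∈ Literature.Probability.Percolation.openConn o x).card ∧
            (A.filter fun x => ω ∈ Literature.Probability.Percolation.openConn o x).card ≤ 1} ≤
      (Literature.Probability.LatticeModels.prodBernoulli w).real
        {ω : Literature.Probability.Percolation.BondConfig (Fin n) |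
          (A.filter fun x => ω ∈ Literature.Probability.Percolation.openConn q x).card ≤ 1 ∧
            1 ≤ (A.filter fun x => ω ∈ Literature.Probability.Percolation.openConn o x).card} := by
  have hTS := stub_terminalSeparation fun n w s X F G hF hG hs =>
    BHK2006_clusterConditionalPositiveAssociation_holds (Fin n) w s X F G hF hG hs
  have hchamp' : ∀ b ∈ A, (prodBernoulli w).real {ω | ∀ t ∈ A.erase b, ω ∉ openConn b t} ≤
      (prodBernoulli w).real {ω | ∀ t ∈ A.erase q, ω ∉ openConn q t} := by
    intro b hb
    have h := hchamp b hb
    rw [setOf_card_le_one_eq A hb, setOf_card_le_one_eq A hq] at h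
    exact h
  have key := level_one_of_terminalSeparation hTS stub_weightContinuity w A o q hq hchamp'
  have hev : {ω : BondConfig (Fin n) |
      (A.filter fun x => ω ∈ openConn q x).card ≤ 1 ∧ 1 ≤ (A.filter fun x => ω ∈ openConn o x).card} =
      {ω | ∀ t ∈ A.erase q, ω ∉ openConn q t} ∩ ⋃ a ∈ A, openConn o a := by
    rw [← setOf_card_le_one_eq A hq, ← setOf_one_le_card_eq A o]
    rfl
  rw [← setOf_card_eq_one_eq A o, hev]
  exact key

end Summit.CriticalPhenomena.PercolationContinuityZ3.Theorems

end
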